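/-
Copyright (c) 2026 the pub-hodgecm-mathlib formalisation cell (harness21).  Prover seat hodgecm-mathlib-LH3-p02 (g5): line LH3 (closer stub `stub_N9`), LETTER L3′ SURJ-OF-FORWARD,
organ (Σ-WALL) — FILTRATION ROAD (W-ROAD CENSUS v1 6129001bfae4ccc0, RULING #26), brick (W3-G) part 3b: the TWO-SIDED compact reading of the compact-type generator.
-/
import Literature.NumberTheory.Rogawski1990.ArchRankOneWallGenerators             -- ★ p851615 (this seat), (W3-G) part 2b: `exists_compactType_wallGenerator` ((G1-w) + (G3-w)); brings ★ (R1G) signed, ★ frame identity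
import Literature.NumberTheory.Automorphic.ArchRankOneCasimirUniformJump          -- ★ (ELL-∞-JUMP-UNIF) `RankOneCasimir.exists_tendsto_iteratedDeriv_orbitalIntegral_uniform_circle_of_contDiff` (centre-uniform one-sided limits of every jet)
import Literature.NumberTheory.Automorphic.ArchEndoscopicChartSplitConeLimit       -- ★ (A0-DOCKED-JOINT) `exists_tendsto_absExpSub_mul_chartOrbHLoc_cone` (split reading → `D ·` cone)
import Literature.NumberTheory.Automorphic.ArchEndoscopicChartOrbPlaces            -- ★ (P4) `chartOrbHLoc_eq_integral_of_not_mem` (compact place: the functional IS the group orbital integral)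
import Literature.NumberTheory.Rogawski1990.ArchRankOneWallTwoSidedQuotient       -- ★ (this seat), (W3-G) part 3a: `tendsto_sub_apply_neg_div_two_mul_sin`, `nhdsWithin_ne_zero_vecCons_neBot`
import HarnessLib

/-!
# (W3-G), PART 3b: THE TWO-SIDED COMPACT READING OF THE COMPACT-TYPE GENERATOR AT A CENTRAL BLOCK — `hGcp` OF (W3-asm)
# (Shelstad 1979 Lemma 4.3, Thm. 4.7 (IIIb); Varadarajan 1989 §6.4 Thms 22–24; Rogawski 1990 §8.2; Bouaziz 1994 §3.2 (I₃))

Topic `NumberTheory/Rogawski1990`; namespace `Literature.NumberTheory.Rogawski1990`.  THEOREMS ONLY (no `def`, no instance, no notation, no axiom, no named fact, no `sorry`).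
Cell `pub/hodgecm-mathlib`, crux H413 (`stmt-HodgeConjecture-24833`), F0∕P3c line LH3 (closer stub `stub_N9`), LETTER L3′ SURJ-OF-FORWARD, organ (Σ-WALL) = `hwall` of ★
`bouazizSurjOfForward_of_reg_wall`, FILTRATION ROAD (W-ROAD CENSUS v1, LH3-p01 (g6); RULING #26): brick **(W3-G)** part 3 = the `hGcp` hypothesis of the (W3-asm) generator package
(F0P3a-p08 (g24) sigfirst dc227eb0, R-696) TOKEN FOR TOKEN after the frame binders: the compact-type generator `f₀` of ★ part 2b with (G1-w) (its split readings vanish near the wall) AND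
(G3-w-cor) (its TWO-SIDED compact reading `chartOrbHLoc v + chartOrbHLoc v^flip` at every compact place `w ∉ S` has the non-zero limit `ℓ = C · f₀(z·1) = C < 0` at every wall point
`v₀` over the centre `z = e^{iθ₀}`, jointly in the three local coordinates, within the regular set `{e^{i v 0} ≠ e^{i v 2}}`).

THE MATHEMATICS (`G_z(ψ) = 2 sin ψ · ∫_{U(Φ₂)_w} f₀(↑↑(h · P t_z(ψ) P⁻¹ · h⁻¹)) dν_w`).  At a compact place the chart functional IS the group orbital integral (★ (P4)) at the Cayley
block `P·diag(e^{iv₀}, e^{iv₂})·P⁻¹`; with `e^{iv₀} = z e^{iψ}`, `e^{iv₂} = z e^{−iψ}` the two-sided reading is `[G_z(ψ) − G_z(−ψ)] ∕ (2 sin ψ)`.  ORDER 0: `G_z(0^±) = ±C₁·cone^±(f₀, z)`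
(★ (K0±-Cayley)) and `cone⁺ + cone⁻` VANISHES at every centre near `e^{iθ₀}` — it is `D⁻¹ ×` the limit of the normalised split reading (★ (A0-DOCKED-JOINT)), zero near the wall by
(G1-w).  ORDER 1, UNIFORMLY IN THE CENTRE (rider (3u)): `∂_ψ G_z(ψ) → C·f₀(z·1)` uniformly in `z ∈ S¹` (★ (R1G) signed + ★ (ELL-∞-JUMP-UNIF) at `n = 1`, transported to the Cayley
frame by ★ `exists_two_sin_smul_orbitalIntegral_cayley_eq`).  The pure-analysis quotient lemma of ★ part 3a then gives the joint limit `C·f₀(e^{iθ₀}·1) = C < 0`.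
HONEST LABEL: HC_CM is proved only modulo the 7 printed citations (2 remaining: hLiu418 = `stmt-HodgeConjecture-24832`, h413 = `stmt-HodgeConjecture-24833`) until rung 0 closes;
rank-one analysis over the ★ kit, count-neutral, pays nothing by itself.

WHAT IS PROVED.  §1 (frame) `endoBlockAt_of_not_mem`, `chartOrbHLoc_eq_integral_cayley_of_not_mem`.  §2 **`exists_deriv_two_sin_smul_orbitalIntegral_cayley_uniform`** ((R1G) + (3u) in the Cayley
frame).  §3 `tendsto_sub_nhdsGT_zero_of_splitReadings_eq_zero` ((G1-w) ⇒ the odd-ised order-0 value vanishes).  §4 **`exists_compactType_wallGenerator_twoSided`** (= `hGcp`).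

## References
* [Shelstad1979] D. Shelstad, *Characters and inner forms of a quasi-split group over ℝ*, Compositio Math. 39 (1979), Lemma 4.3 p. 25, Thm. 4.7 (IIIb) p. 31.
* [Varadarajan1989] V. S. Varadarajan, *An Introduction to Harmonic Analysis on Semisimple Lie Groups*, Cambridge Stud. Adv. Math. 16 (1989), §6.4 Thms 22–24.
* [Rogawski1990] J. D. Rogawski, *Automorphic Representations of Unitary Groups in Three Variables*, Ann. of Math. Stud. 123 (1990), §8.2 Prop. 8.2.1 p. 119, pp. 122–123.
* [Bouaziz1994IntegralesOrbitales] A. Bouaziz, *Intégrales orbitales sur les groupes de Lie réductifs*, Ann. Sci. ÉNS 27 (1994), §3.2 (I₃) p. 580; §4 pp. 585–586.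
-/

set_option autoImplicit false

noncomputable section

open MeasureTheory MeasureTheory.Measure Set Filter Topology NumberField NumberField.InfinitePlace Complex Function
open scoped ENNReal NNReal ComplexConjugate Real MatrixGroups Matrix ContDiff Matrix.Norms.Operator

namespace Literature.NumberTheory.Rogawski1990

open Literature.NumberTheory.Automorphic Literature.NumberTheory.Automorphic.UnitaryGroup Literature.MeasureTheory.Group

/-! ## §1 Frame: the chart functional at a compact place along the Cayley torus -/

section Frame

variable (L : Type) [Field L] [NumberField L] [IsCMField L] (S : Finset {w : InfinitePlace L // IsComplex w}) (w : {w : InfinitePlace L // IsComplex w})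

omit [NumberField L] [IsCMField L] in
/-- **At a compact place `w ∉ S` the chart point is the Cayley block** `P·diag(e^{i cw 0}, e^{i cw 2})·P⁻¹` (★ `endoBlock`, definitional). [cite: Rogawski1990, §8.2 p. 122] -/
theorem endoBlockAt_of_not_mem (hw : w ∉ S) (cw : Fin 3 → ℝ) :
    endoBlockAt L S w cw = ⟨Matrix.GeneralLinearGroup.mkOfDetNeZero !![(1 : ℂ), 1; 1, -1] det_cayleyTwo_ne_zero *
        circleDiagonal 2 ![Circle.exp (cw 0), Circle.exp (cw 2)] * (Matrix.GeneralLinearGroup.mkOfDetNeZero !![(1 : ℂ), 1; 1, -1] det_cayleyTwo_ne_zero)⁻¹,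
      cayley_conj_circleDiagonal_mem_archLocal L w _⟩ := by
  show endoBlock L S (fun _ => cw) w = _
  unfold endoBlock
  rw [if_neg hw]

variable [MeasurableSpace ↥(archLocal L 2 (Matrix.of fun i j : Fin 2 => if i.val + j.val + 1 = 2 then (1 : L) else 0) w)]
  [BorelSpace ↥(archLocal L 2 (Matrix.of fun i j : Fin 2 => if i.val + j.val + 1 = 2 then (1 : L) else 0) w)]
  (νw : Measure ↥(archLocal L 2 (Matrix.of fun i j : Fin 2 => if i.val + j.val + 1 = 2 then (1 : L) else 0) w)) [νw.IsHaarMeasure] [νw.IsMulRightInvariant]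

/-- **(P4) ALONG THE CAYLEY TORUS**: at a compact place `w ∉ S`, if `e^{i cw 0} = z e^{iψ}` and `e^{i cw 2} = z e^{−iψ}` then
`chartOrbHLoc L S w ν_w (f ∘ coe) cw = ∫_{U(Φ₂)_w} f(↑↑(h · P t_z(ψ) P⁻¹ · h⁻¹)) dν_w` (★ (P4) + `endoBlockAt_of_not_mem`). [cite: Rogawski1990, §8.2 p. 122; §8.3 p. 124] -/
theorem chartOrbHLoc_eq_integral_cayley_of_not_mem (hw : w ∉ S) (f : Matrix (Fin 2) (Fin 2) ℂ → ℂ) (hf : Continuous f) {cw : Fin 3 → ℝ} {z : Circle} {ψ : ℝ}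
    (h0 : Circle.exp (cw 0) = z * Circle.exp ψ) (h2 : Circle.exp (cw 2) = z * Circle.exp (-ψ)) :
    chartOrbHLoc L S w νw (fun g => f ((g : GL (Fin 2) ℂ) : Matrix (Fin 2) (Fin 2) ℂ)) cw =
      ∫ h : ↥(archLocal L 2 (Matrix.of fun i j : Fin 2 => if i.val + j.val + 1 = 2 then (1 : L) else 0) w),
        f (((h * ⟨Matrix.GeneralLinearGroup.mkOfDetNeZero !![(1 : ℂ), 1; 1, -1] det_cayleyTwo_ne_zero *
              circleDiagonal 2 ![z * Circle.exp ψ, z * Circle.exp (-ψ)] *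
              (Matrix.GeneralLinearGroup.mkOfDetNeZero !![(1 : ℂ), 1; 1, -1] det_cayleyTwo_ne_zero)⁻¹,
            cayley_conj_circleDiagonal_mem_archLocal L w _⟩ * h⁻¹ :
          ↥(archLocal L 2 (Matrix.of fun i j : Fin 2 => if i.val + j.val + 1 = 2 then (1 : L) else 0) w)) : GL (Fin 2) ℂ) : Matrix (Fin 2) (Fin 2) ℂ) ∂νw := by
  have hmeas : Measurable fun g : ↥(archLocal L 2 (Matrix.of fun i j : Fin 2 => if i.val + j.val + 1 = 2 then (1 : L) else 0) w) =>
      f ((g : GL (Fin 2) ℂ) : Matrix (Fin 2) (Fin 2) ℂ) :=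
    (hf.comp (Units.continuous_val.comp continuous_subtype_val)).measurable
  rw [chartOrbHLoc_eq_integral_of_not_mem L S w νw hw _ hmeas cw, endoBlockAt_of_not_mem L S w hw cw]
  have hvec : (![Circle.exp (cw 0), Circle.exp (cw 2)] : Fin 2 → Circle) = ![z * Circle.exp ψ, z * Circle.exp (-ψ)] := by
    rw [h0, h2]
  simp_rw [hvec]

end Frame

/-! ## §2 Harish-Chandra's first-order limit in the Cayley frame, UNIFORMLY in the centre ((R1G) + rider (3u)) -/

section Uniform

variable (L : Type) [Field L] [NumberField L] [IsCMField L] (w : {w : InfinitePlace L // IsComplex w})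
  [MeasurableSpace ↥(archLocal L 2 (Matrix.of fun i j : Fin 2 => if i.val + j.val + 1 = 2 then (1 : L) else 0) w)]
  [BorelSpace ↥(archLocal L 2 (Matrix.of fun i j : Fin 2 => if i.val + j.val + 1 = 2 then (1 : L) else 0) w)]
  (νw : Measure ↥(archLocal L 2 (Matrix.of fun i j : Fin 2 => if i.val + j.val + 1 = 2 then (1 : L) else 0) w)) [νw.IsHaarMeasure] [νw.IsMulRightInvariant]

omit [IsCMField L] in
/-- **(R1G) + (3u), CAYLEY FRAME OF `U(Φ₂)_w`, UNIFORMLY IN THE CENTRE.**  For every Haar `ν_w` there is ONE `C < 0` such that for every `f ∈ C_c^∞(M₂(ℂ), ℂ)`, with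
`G_z(ψ) = 2 sin ψ · ∫ f(↑↑(h · P t_z(ψ) P⁻¹ · h⁻¹)) dν_w`: (a) `G_z` is differentiable at every `ψ ∈ (−1, 1) ∖ {0}`; (b) `∂G_z(ψ) → C · f(z·1)` as `ψ → 0`, `ψ ≠ 0`, for every centre
`z ∈ S¹` (★ (R1G) signed); (c) for every `ε > 0` ONE punctured neighbourhood of `0` gives `‖∂G_z(ψ) − C·f(z·1)‖ ≤ ε` for ALL `z ∈ S¹` (★ (ELL-∞-JUMP-UNIF), `n = 1`, with the one-sided
limit functions identified with `C·f(z·1)` by (b)).  Both inputs live on the diagonal frame `U(σ_w diag(2,−2))` and are transported by ★ `exists_two_sin_smul_orbitalIntegral_cayley_eq`.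
[cite: Varadarajan1989, §6.4 Thms 22–24] [cite: Rogawski1990, §8.2 Prop. 8.2.1 p. 119] [cite: Bouaziz1994IntegralesOrbitales, §3.2 (I₃) p. 580] -/
theorem exists_deriv_two_sin_smul_orbitalIntegral_cayley_uniform :
    ∃ C : ℝ, C < 0 ∧ ∀ (f : Matrix (Fin 2) (Fin 2) ℂ → ℂ), ContDiff ℝ ∞ f → HasCompactSupport f →
      (∀ (z : Circle), ∀ ψ ∈ Ioo (-1 : ℝ) 1, ψ ≠ 0 → DifferentiableAt ℝ (fun ψ : ℝ => (2 * Real.sin ψ) •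
          ∫ h : ↥(archLocal L 2 (Matrix.of fun i j : Fin 2 => if i.val + j.val + 1 = 2 then (1 : L) else 0) w),
            f (((h * ⟨Matrix.GeneralLinearGroup.mkOfDetNeZero !![(1 : ℂ), 1; 1, -1] det_cayleyTwo_ne_zero *
                  circleDiagonal 2 ![z * Circle.exp ψ, z * Circle.exp (-ψ)] *
                  (Matrix.GeneralLinearGroup.mkOfDetNeZero !![(1 : ℂ), 1; 1, -1] det_cayleyTwo_ne_zero)⁻¹,
                cayley_conj_circleDiagonal_mem_archLocal L w _⟩ * h⁻¹ :
              ↥(archLocal L 2 (Matrix.of fun i j : Fin 2 => if i.val + j.val + 1 = 2 then (1 : L) else 0) w)) : GL (Fin 2) ℂ) : Matrix (Fin 2) (Fin 2) ℂ) ∂νw) ψ) ∧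
      (∀ z : Circle, Tendsto (fun ψ : ℝ => deriv (fun ψ : ℝ => (2 * Real.sin ψ) •
          ∫ h : ↥(archLocal L 2 (Matrix.of fun i j : Fin 2 => if i.val + j.val + 1 = 2 then (1 : L) else 0) w),
            f (((h * ⟨Matrix.GeneralLinearGroup.mkOfDetNeZero !![(1 : ℂ), 1; 1, -1] det_cayleyTwo_ne_zero *
                  circleDiagonal 2 ![z * Circle.exp ψ, z * Circle.exp (-ψ)] *
                  (Matrix.GeneralLinearGroup.mkOfDetNeZero !![(1 : ℂ), 1; 1, -1] det_cayleyTwo_ne_zero)⁻¹,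
                cayley_conj_circleDiagonal_mem_archLocal L w _⟩ * h⁻¹ :
              ↥(archLocal L 2 (Matrix.of fun i j : Fin 2 => if i.val + j.val + 1 = 2 then (1 : L) else 0) w)) : GL (Fin 2) ℂ) : Matrix (Fin 2) (Fin 2) ℂ) ∂νw) ψ)
        (𝓝[≠] 0) (𝓝 (((C : ℝ) : ℂ) * f ((z : ℂ) • (1 : Matrix (Fin 2) (Fin 2) ℂ))))) ∧
      ∀ ε : ℝ, 0 < ε → ∀ᶠ ψ in 𝓝[≠] (0 : ℝ), ∀ z : Circle, ‖deriv (fun ψ : ℝ => (2 * Real.sin ψ) •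
          ∫ h : ↥(archLocal L 2 (Matrix.of fun i j : Fin 2 => if i.val + j.val + 1 = 2 then (1 : L) else 0) w),
            f (((h * ⟨Matrix.GeneralLinearGroup.mkOfDetNeZero !![(1 : ℂ), 1; 1, -1] det_cayleyTwo_ne_zero *
                  circleDiagonal 2 ![z * Circle.exp ψ, z * Circle.exp (-ψ)] *
                  (Matrix.GeneralLinearGroup.mkOfDetNeZero !![(1 : ℂ), 1; 1, -1] det_cayleyTwo_ne_zero)⁻¹,
                cayley_conj_circleDiagonal_mem_archLocal L w _⟩ * h⁻¹ :
              ↥(archLocal L 2 (Matrix.of fun i j : Fin 2 => if i.val + j.val + 1 = 2 then (1 : L) else 0) w)) : GL (Fin 2) ℂ) : Matrix (Fin 2) (Fin 2) ℂ) ∂νw) ψ -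
          ((C : ℝ) : ℂ) * f ((z : ℂ) • (1 : Matrix (Fin 2) (Fin 2) ℂ))‖ ≤ ε := by
  obtain ⟨e, hHaar, hRinv, hkey⟩ := exists_two_sin_smul_orbitalIntegral_cayley_eq (E := ℂ) L w νw
  letI iD : MeasurableSpace ↥(unitaryGroupOfForm (starRingEnd ℂ) ((Matrix.diagonal ![(2 : L), -2]).map w.1.embedding)) := borel _
  haveI : BorelSpace ↥(unitaryGroupOfForm (starRingEnd ℂ) ((Matrix.diagonal ![(2 : L), -2]).map w.1.embedding)) := ⟨rfl⟩
  haveI : (νw.map e.symm).IsHaarMeasure := hHaar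
  haveI : (νw.map e.symm).IsMulRightInvariant := hRinv
  have ha : ∀ i, (![(2 : L), -2] i) ≠ 0 := by
    intro i; fin_cases i
    · exact (two_ne_zero : (2 : L) ≠ 0)
    · exact (neg_ne_zero.2 two_ne_zero : (-2 : L) ≠ 0)
  have hreal : ∀ i, (w.1.embedding (![(2 : L), -2] i)).im = 0 := by
    intro i; fin_cases i
    · show (w.1.embedding 2).im = 0; rw [map_ofNat]; norm_num
    · show (w.1.embedding (-2)).im = 0; rw [map_neg, map_ofNat]; norm_num
  have hsgn : (w.1.embedding (![(2 : L), -2] 0)).re * (w.1.embedding (![(2 : L), -2] 1)).re < 0 := by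
    show (w.1.embedding 2).re * (w.1.embedding (-2)).re < 0
    rw [map_neg, map_ofNat]; norm_num
  have hqe : ((1 : ℝ) : ℂ) ^ 2 * w.1.embedding (![(2 : L), -2] 1) = -w.1.embedding (![(2 : L), -2] 0) := by
    show ((1 : ℝ) : ℂ) ^ 2 * w.1.embedding (-2) = -w.1.embedding 2
    rw [map_neg]; push_cast; ring
  obtain ⟨C, hC, hlim⟩ := exists_tendsto_deriv_two_sin_smul_orbitalIntegral_neg (E := ℂ) w.1.embedding ![(2 : L), -2] hreal hsgn (νw.map e.symm)
  refine ⟨C, hC, fun f hf hfc => ?_⟩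
  -- the transported test function `g = f ∘ Ad(P)`: smooth, compactly supported, same central values
  set g : Matrix (Fin 2) (Fin 2) ℂ → ℂ := fun X => f ((!![(1 : ℂ), 1; 1, -1] : Matrix (Fin 2) (Fin 2) ℂ) * X * !![(1 / 2 : ℂ), 1 / 2; 1 / 2, -(1 / 2)]) with hg
  have hPP : ((!![(1 : ℂ), 1; 1, -1] : Matrix (Fin 2) (Fin 2) ℂ) * !![(1 / 2 : ℂ), 1 / 2; 1 / 2, -(1 / 2)]) = 1 := by
    rw [Matrix.mul_fin_two, Matrix.one_fin_two]; norm_num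
  have hP'P : ((!![(1 / 2 : ℂ), 1 / 2; 1 / 2, -(1 / 2)] : Matrix (Fin 2) (Fin 2) ℂ) * !![(1 : ℂ), 1; 1, -1]) = 1 := by
    rw [Matrix.mul_fin_two, Matrix.one_fin_two]; norm_num
  have hφc : ContDiff ℝ ∞ fun X : Matrix (Fin 2) (Fin 2) ℂ => ((!![(1 : ℂ), 1; 1, -1] : Matrix (Fin 2) (Fin 2) ℂ) * X * !![(1 / 2 : ℂ), 1 / 2; 1 / 2, -(1 / 2)]) :=
    (contDiff_const.mul contDiff_id).mul contDiff_const
  have hgs : ContDiff ℝ ∞ g := hf.comp hφc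
  have hg1 : ContDiff ℝ 1 g := hgs.of_le (by exact_mod_cast le_top)
  have hgc : HasCompactSupport g := by
    let φ : Matrix (Fin 2) (Fin 2) ℂ ≃ₜ Matrix (Fin 2) (Fin 2) ℂ :=
      { toFun := fun X => ((!![(1 : ℂ), 1; 1, -1] : Matrix (Fin 2) (Fin 2) ℂ) * X * !![(1 / 2 : ℂ), 1 / 2; 1 / 2, -(1 / 2)])
        invFun := fun X => ((!![(1 / 2 : ℂ), 1 / 2; 1 / 2, -(1 / 2)] : Matrix (Fin 2) (Fin 2) ℂ) * X * !![(1 : ℂ), 1; 1, -1])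
        left_inv := fun X => by
          show !![(1 / 2 : ℂ), 1 / 2; 1 / 2, -(1 / 2)] * (!![(1 : ℂ), 1; 1, -1] * X * !![(1 / 2 : ℂ), 1 / 2; 1 / 2, -(1 / 2)]) * !![(1 : ℂ), 1; 1, -1] = X
          rw [← Matrix.mul_assoc, ← Matrix.mul_assoc, hP'P, Matrix.one_mul, Matrix.mul_assoc, hP'P, Matrix.mul_one]
        right_inv := fun X => by
          show !![(1 : ℂ), 1; 1, -1] * (!![(1 / 2 : ℂ), 1 / 2; 1 / 2, -(1 / 2)] * X * !![(1 : ℂ), 1; 1, -1]) * !![(1 / 2 : ℂ), 1 / 2; 1 / 2, -(1 / 2)] = X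
          rw [← Matrix.mul_assoc, ← Matrix.mul_assoc, hPP, Matrix.one_mul, Matrix.mul_assoc, hPP, Matrix.mul_one]
        continuous_toFun := (continuous_const.mul continuous_id).mul continuous_const
        continuous_invFun := (continuous_const.mul continuous_id).mul continuous_const }
    exact hfc.comp_homeomorph φ
  have hgz : ∀ z : Circle, g ((z : ℂ) • (1 : Matrix (Fin 2) (Fin 2) ℂ)) = f ((z : ℂ) • (1 : Matrix (Fin 2) (Fin 2) ℂ)) := fun z => by
    simp only [hg, Matrix.mul_smul, Matrix.mul_one, Matrix.smul_mul, hPP]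
  -- the Cayley functional of `f` IS the diagonal functional of `g`, for every centre
  have hfun : ∀ z : Circle, (fun ψ : ℝ => (2 * Real.sin ψ) •
      ∫ h : ↥(archLocal L 2 (Matrix.of fun i j : Fin 2 => if i.val + j.val + 1 = 2 then (1 : L) else 0) w),
        f (((h * ⟨Matrix.GeneralLinearGroup.mkOfDetNeZero !![(1 : ℂ), 1; 1, -1] det_cayleyTwo_ne_zero *
              circleDiagonal 2 ![z * Circle.exp ψ, z * Circle.exp (-ψ)] *
              (Matrix.GeneralLinearGroup.mkOfDetNeZero !![(1 : ℂ), 1; 1, -1] det_cayleyTwo_ne_zero)⁻¹,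
            cayley_conj_circleDiagonal_mem_archLocal L w _⟩ * h⁻¹ :
          ↥(archLocal L 2 (Matrix.of fun i j : Fin 2 => if i.val + j.val + 1 = 2 then (1 : L) else 0) w)) : GL (Fin 2) ℂ) : Matrix (Fin 2) (Fin 2) ℂ) ∂νw) =
      fun ψ : ℝ => (2 * Real.sin ψ) • ∫ h' : ↥(unitaryGroupOfForm (starRingEnd ℂ) ((Matrix.diagonal ![(2 : L), -2]).map w.1.embedding)),
        g (((h' * ⟨circleDiagonal 2 ![z * Circle.exp ψ, z * Circle.exp (-ψ)], circleDiagonal_mem_archLocal_diagonal L 2 ![(2 : L), -2] w _⟩ * h'⁻¹ :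
          ↥(unitaryGroupOfForm (starRingEnd ℂ) ((Matrix.diagonal ![(2 : L), -2]).map w.1.embedding))) : GL (Fin 2) ℂ) : Matrix (Fin 2) (Fin 2) ℂ) ∂(νw.map e.symm) :=
    fun z => funext fun ψ => hkey f z ψ
  -- ★ (ELL-∞-JUMP-UNIF) at `n = 1` on the diagonal frame
  obtain ⟨Lp, Lm, hptw, hunif⟩ := Literature.NumberTheory.Automorphic.RankOneCasimir.exists_tendsto_iteratedDeriv_orbitalIntegral_uniform_circle_of_contDiff
      L ![(2 : L), -2] w ha hreal hsgn (p := 1) (q := 1) (by norm_num) hqe (νw.map e.symm)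
      (fun (z : Circle) (f : Matrix (Fin 2) (Fin 2) ℂ → ℂ) (ψ : ℝ) => (2 * Real.sin ψ) •
        ∫ h' : ↥(unitaryGroupOfForm (starRingEnd ℂ) ((Matrix.diagonal ![(2 : L), -2]).map w.1.embedding)),
          f (((h' * ⟨circleDiagonal 2 ![z * Circle.exp ψ, z * Circle.exp (-ψ)], circleDiagonal_mem_archLocal_diagonal L 2 ![(2 : L), -2] w _⟩ * h'⁻¹ :
            ↥(unitaryGroupOfForm (starRingEnd ℂ) ((Matrix.diagonal ![(2 : L), -2]).map w.1.embedding))) : GL (Fin 2) ℂ) : Matrix (Fin 2) (Fin 2) ℂ) ∂(νw.map e.symm))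
      (fun _ _ _ => rfl) hgs hgc 1
  -- the one-sided limit functions ARE `C · f(z·1)` (uniqueness of limits against ★ (R1G))
  have hLp : ∀ z : Circle, Lp z = ((C : ℝ) : ℂ) * f ((z : ℂ) • (1 : Matrix (Fin 2) (Fin 2) ℂ)) := fun z => by
    have h1 := (hptw z).1; simp only [iteratedDeriv_one] at h1
    have h2 := ((hlim g hg1 hgc z).1).mono_left (nhdsGT_le_nhdsNE (0 : ℝ))
    rw [tendsto_nhds_unique h1 h2, hgz, Complex.real_smul]
  have hLm : ∀ z : Circle, Lm z = ((C : ℝ) : ℂ) * f ((z : ℂ) • (1 : Matrix (Fin 2) (Fin 2) ℂ)) := fun z => by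
    have h1 := (hptw z).2; simp only [iteratedDeriv_one] at h1
    have h2 := ((hlim g hg1 hgc z).1).mono_left (nhdsLT_le_nhdsNE (0 : ℝ))
    rw [tendsto_nhds_unique h1 h2, hgz, Complex.real_smul]
  refine ⟨fun z ψ hψ hψ0 => ?_, fun z => ?_, fun ε hε => ?_⟩
  · rw [hfun z]
    exact (hlim g hg1 hgc z).2 ψ hψ hψ0
  · rw [hfun z, ← hgz z, ← Complex.real_smul]
    exact (hlim g hg1 hgc z).1
  · obtain ⟨h1, h2⟩ := hunif ε hε
    rw [← nhdsLT_sup_nhdsGT, eventually_sup]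
    refine ⟨?_, ?_⟩
    · filter_upwards [h2] with ψ hψ z; rw [hfun z, ← hLm z, ← iteratedDeriv_one]; exact hψ z
    · filter_upwards [h1] with ψ hψ z; rw [hfun z, ← hLp z, ← iteratedDeriv_one]; exact hψ z

end Uniform

/-! ## §3 (G1-w) ⇒ the odd-ised order-0 value at the centre vanishes -/

section ConeZero

variable (L : Type) [Field L] [NumberField L] [IsCMField L] (w : {w : InfinitePlace L // IsComplex w})
  [MeasurableSpace ↥(archLocal L 2 (Matrix.of fun i j : Fin 2 => if i.val + j.val + 1 = 2 then (1 : L) else 0) w)]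
  [BorelSpace ↥(archLocal L 2 (Matrix.of fun i j : Fin 2 => if i.val + j.val + 1 = 2 then (1 : L) else 0) w)]
  (νw : Measure ↥(archLocal L 2 (Matrix.of fun i j : Fin 2 => if i.val + j.val + 1 = 2 then (1 : L) else 0) w)) [νw.IsHaarMeasure] [νw.IsMulRightInvariant]

/-- **VANISHING SPLIT READINGS NEAR THE WALL KILL THE ORDER-0 JUMP OF THE TWO-SIDED READING.**  If the split readings of `f ∈ C_c(M₂(ℂ))` vanish for `0 < |x| < δ` at angles
`δ`-near `θ₀` ((G1-w)), then at every centre `z` with `dist z e^{iθ₀} < δ` the full cone value of `f` vanishes (★ (A0-DOCKED-JOINT): it is `D⁻¹ ×` the limit of the normalised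
split reading, `D > 0`), hence by ★ (K0±-Cayley) (`G_z(0⁺) = C₁ cone⁺`, `G_z(0⁻) = −C₁ cone⁻`) the odd-ised value `G_z(ψ) − G_z(−ψ) → C₁ (cone⁺ + cone⁻) = 0` as `ψ → 0⁺`.
[cite: Shelstad1979, Lemma 4.3 p. 25] [cite: Varadarajan1989, §6.4 Thm 23] [cite: Rogawski1990, §8.2 pp. 119, 122] -/
theorem tendsto_sub_nhdsGT_zero_of_splitReadings_eq_zero {f : Matrix (Fin 2) (Fin 2) ℂ → ℂ} (hf : Continuous f) (hfc : HasCompactSupport f) {θ₀ δ : ℝ}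
    (hG1 : ∀ S : Finset {w : InfinitePlace L // IsComplex w}, w ∈ S → ∀ cw : Fin 3 → ℝ, cw 0 ≠ 0 → |cw 0| < δ → dist (Circle.exp (cw 2)) (Circle.exp θ₀) < δ →
      chartOrbHLoc L S w νw (fun g => f ((g : GL (Fin 2) ℂ) : Matrix (Fin 2) (Fin 2) ℂ)) cw = 0)
    {z : Circle} (hz : dist z (Circle.exp θ₀) < δ) :
    Tendsto (fun ψ : ℝ => (2 * Real.sin ψ) •
        (∫ h : ↥(archLocal L 2 (Matrix.of fun i j : Fin 2 => if i.val + j.val + 1 = 2 then (1 : L) else 0) w),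
          f (((h * ⟨Matrix.GeneralLinearGroup.mkOfDetNeZero !![(1 : ℂ), 1; 1, -1] det_cayleyTwo_ne_zero *
                circleDiagonal 2 ![z * Circle.exp ψ, z * Circle.exp (-ψ)] *
                (Matrix.GeneralLinearGroup.mkOfDetNeZero !![(1 : ℂ), 1; 1, -1] det_cayleyTwo_ne_zero)⁻¹,
              cayley_conj_circleDiagonal_mem_archLocal L w _⟩ * h⁻¹ :
            ↥(archLocal L 2 (Matrix.of fun i j : Fin 2 => if i.val + j.val + 1 = 2 then (1 : L) else 0) w)) : GL (Fin 2) ℂ) : Matrix (Fin 2) (Fin 2) ℂ) ∂νw) -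
      (2 * Real.sin (-ψ)) •
        (∫ h : ↥(archLocal L 2 (Matrix.of fun i j : Fin 2 => if i.val + j.val + 1 = 2 then (1 : L) else 0) w),
          f (((h * ⟨Matrix.GeneralLinearGroup.mkOfDetNeZero !![(1 : ℂ), 1; 1, -1] det_cayleyTwo_ne_zero *
                circleDiagonal 2 ![z * Circle.exp (-ψ), z * Circle.exp (-(-ψ))] *
                (Matrix.GeneralLinearGroup.mkOfDetNeZero !![(1 : ℂ), 1; 1, -1] det_cayleyTwo_ne_zero)⁻¹,
              cayley_conj_circleDiagonal_mem_archLocal L w _⟩ * h⁻¹ :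
            ↥(archLocal L 2 (Matrix.of fun i j : Fin 2 => if i.val + j.val + 1 = 2 then (1 : L) else 0) w)) : GL (Fin 2) ℂ) : Matrix (Fin 2) (Fin 2) ℂ) ∂νw))
      (𝓝[>] 0) (𝓝 0) := by
  have hδ : 0 < δ := lt_of_le_of_lt dist_nonneg hz
  -- write `z = e^{iθ}`
  obtain ⟨θ, rfl⟩ : ∃ θ : ℝ, Circle.exp θ = z := ⟨_, Circle.exp_arg z⟩
  -- ★ (A0-DOCKED-JOINT) at `S = {w}`, angle `θ`: the normalised split reading tends to `D · (cone⁺ + cone⁻)`, and it is eventually `0`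
  obtain ⟨D, hD, hcone⟩ := exists_tendsto_absExpSub_mul_chartOrbHLoc_cone L w νw
  have hlimD := hcone {w} (Finset.mem_singleton_self w) f hf hfc 0 θ
  haveI := nhdsWithin_ne_zero_vecCons_neBot 0 θ
  have hev0 : ∀ᶠ v : Fin 3 → ℝ in 𝓝[{v : Fin 3 → ℝ | v 0 ≠ 0}] (![0, 0, θ] : Fin 3 → ℝ),
      (((|Real.exp (v 0) - Real.exp (-v 0)| : ℝ) : ℂ) * chartOrbHLoc L {w} w νw (fun g => f ((g : GL (Fin 2) ℂ) : Matrix (Fin 2) (Fin 2) ℂ)) v) = 0 := by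
    have h1 : ∀ᶠ v : Fin 3 → ℝ in 𝓝 (![0, 0, θ] : Fin 3 → ℝ), |v 0| < δ :=
      ((continuous_apply 0).abs.tendsto _).eventually_lt tendsto_const_nhds (by simpa using hδ)
    have h2 : ∀ᶠ v : Fin 3 → ℝ in 𝓝 (![0, 0, θ] : Fin 3 → ℝ), dist (Circle.exp (v 2)) (Circle.exp θ₀) < δ :=
      (((Circle.exp.continuous.comp (continuous_apply 2)).tendsto _).dist tendsto_const_nhds).eventually_lt tendsto_const_nhds (by simpa using hz)
    filter_upwards [self_mem_nhdsWithin, mem_nhdsWithin_of_mem_nhds h1, mem_nhdsWithin_of_mem_nhds h2] with v hv hv1 hv2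
    rw [hG1 {w} (Finset.mem_singleton_self w) v hv hv1 hv2, mul_zero]
  have hzeroD := tendsto_nhds_unique hlimD (tendsto_const_nhds.congr' (hev0.mono fun v hv => hv.symm))
  -- ★ (K0±-Cayley): the one-sided values
  obtain ⟨C₁, hC₁, hK0⟩ := exists_tendsto_two_sin_smul_orbitalIntegral_cayley_nhdsGT_nhdsLT (E := ℂ) L w νw
  obtain ⟨hp, hm⟩ := hK0 f hf hfc (Circle.exp θ)
  have hm' := hm.comp (show Tendsto (fun ψ : ℝ => -ψ) (𝓝[>] (0 : ℝ)) (𝓝[<] (0 : ℝ)) by simpa using tendsto_neg_nhdsGT (a := (0 : ℝ)))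
  have key : ∀ {Ap Am : ℂ} {u : ℝ → ℂ}, Tendsto u (𝓝[>] (0 : ℝ)) (𝓝 (C₁ • Ap)) → Tendsto (fun ψ => u (-ψ)) (𝓝[>] (0 : ℝ)) (𝓝 (C₁ • -Am)) →
      ((D : ℝ) : ℂ) * (Ap + Am) = 0 → Tendsto (fun ψ => u ψ - u (-ψ)) (𝓝[>] (0 : ℝ)) (𝓝 0) := by
    intro Ap Am u hu hu' hDA
    have hsum : Ap + Am = 0 := by
      rcases mul_eq_zero.1 hDA with h | h
      · exact absurd (Complex.ofReal_eq_zero.1 h) hD.ne'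
      · exact h
    have := hu.sub hu'
    rwa [smul_neg, sub_neg_eq_add, ← smul_add, hsum, smul_zero] at this
  exact key hp hm' hzeroD

end ConeZero

/-! ## §4 The head: `hGcp` of (W3-asm) -/

section Head

variable (L : Type) [Field L] [NumberField L] [IsCMField L] (w : {w : InfinitePlace L // IsComplex w})
  [MeasurableSpace ↥(archLocal L 2 (Matrix.of fun i j : Fin 2 => if i.val + j.val + 1 = 2 then (1 : L) else 0) w)]
  [BorelSpace ↥(archLocal L 2 (Matrix.of fun i j : Fin 2 => if i.val + j.val + 1 = 2 then (1 : L) else 0) w)]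
  (νw : Measure ↥(archLocal L 2 (Matrix.of fun i j : Fin 2 => if i.val + j.val + 1 = 2 then (1 : L) else 0) w)) [νw.IsHaarMeasure] [νw.IsMulRightInvariant]

/-- **(W3-G, COMPACT-TYPE GENERATOR, TWO-SIDED READING) = `hGcp` of the (W3-asm) generator package, token for token after the frame binders.**  Inside any prescribed
neighbourhood `U` of the central block `e^{iθ₀}·1` there are an ambient `f₀ ∈ C_c^∞(M₂(ℂ))`, `δ > 0` and `ℓ ≠ 0` with: (G1-w) the split readings of `f₀` vanish near the wall —
`chartOrbHLoc L S w ν_w (f₀ ∘ coe) cw = 0` for every label `S ∋ w`, `0 < |cw 0| < δ`, `dist (e^{i cw 2}) e^{iθ₀} < δ` (★ part 2b); (G3-w-cor) at every compact place `w ∉ S` and every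
wall point `v₀` over the centre (`e^{i v₀ 0} = e^{i v₀ 2} = e^{iθ₀}`) the two-sided reading `chartOrbHLoc … v + chartOrbHLoc … v^flip`, `v^flip = (v 2, v 1, v 0)`, tends to `ℓ`
as `v → v₀` within the regular set `{e^{i v 0} ≠ e^{i v 2}}` — with `ℓ = C · f₀(e^{iθ₀}·1) = C < 0`, Harish-Chandra's constant of ★ (R1G) (★ part 3a abstract lemma fed by §2 (uniform first
order) and §3 (vanishing order 0), read on the chart through §1). [cite: Shelstad1979, Lemma 4.3 p. 25; Thm. 4.7 (IIIb) p. 31] [cite: Varadarajan1989, §6.4 Thms 22–24]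
[cite: Rogawski1990, §8.2 Prop. 8.2.1 p. 119, pp. 122–123] [cite: Bouaziz1994IntegralesOrbitales, §4 pp. 585–586] -/
theorem exists_compactType_wallGenerator_twoSided (θ₀ : ℝ) {U : Set (Matrix (Fin 2) (Fin 2) ℂ)} (hU : U ∈ 𝓝 ((((Circle.exp θ₀ : Circle) : ℂ)) • (1 : Matrix (Fin 2) (Fin 2) ℂ))) :
    ∃ (f₀ : Matrix (Fin 2) (Fin 2) ℂ → ℂ) (δ : ℝ) (ℓ : ℂ), ContDiff ℝ ∞ f₀ ∧ HasCompactSupport f₀ ∧ tsupport f₀ ⊆ U ∧ 0 < δ ∧ ℓ ≠ 0 ∧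
      (∀ S : Finset {w : InfinitePlace L // IsComplex w}, w ∈ S → ∀ cw : Fin 3 → ℝ, cw 0 ≠ 0 → |cw 0| < δ → dist (Circle.exp (cw 2)) (Circle.exp θ₀) < δ →
        chartOrbHLoc L S w νw (fun g => f₀ ((g : GL (Fin 2) ℂ) : Matrix (Fin 2) (Fin 2) ℂ)) cw = 0) ∧
      (∀ S : Finset {w : InfinitePlace L // IsComplex w}, w ∉ S → ∀ v₀ : Fin 3 → ℝ, Circle.exp (v₀ 0) = Circle.exp θ₀ → Circle.exp (v₀ 2) = Circle.exp θ₀ →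
        Tendsto (fun v : Fin 3 → ℝ => chartOrbHLoc L S w νw (fun g => f₀ ((g : GL (Fin 2) ℂ) : Matrix (Fin 2) (Fin 2) ℂ)) v +
            chartOrbHLoc L S w νw (fun g => f₀ ((g : GL (Fin 2) ℂ) : Matrix (Fin 2) (Fin 2) ℂ)) ![v 2, v 1, v 0])
          (𝓝[{v : Fin 3 → ℝ | Circle.exp (v 0) ≠ Circle.exp (v 2)}] v₀) (𝓝 ℓ)) := by
  obtain ⟨f₀, C', δ, hf₀s, hf₀c, hf₀U, hf₀1, -, hδ, hG1, -⟩ := exists_compactType_wallGenerator L w νw θ₀ hU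
  obtain ⟨C, hC, hpack⟩ := exists_deriv_two_sin_smul_orbitalIntegral_cayley_uniform L w νw
  obtain ⟨hdiff, -, hunif⟩ := hpack f₀ hf₀s hf₀c
  refine ⟨f₀, δ, ((C : ℝ) : ℂ), hf₀s, hf₀c, hf₀U, hδ, Complex.ofReal_ne_zero.2 hC.ne, hG1, fun S hwS v₀ hv0 hv2 => ?_⟩
  -- the wall point: `v₀ 0 = v₀ 2 + k · 2π`
  obtain ⟨k, hk⟩ := Circle.exp_eq_exp.1 (hv0.trans hv2.symm)
  -- centre and half-difference coordinates
  obtain ⟨φ, hφ⟩ : ∃ φ : (Fin 3 → ℝ) → ℝ, ∀ v, φ v = (v 0 + v 2) / 2 - k * Real.pi := ⟨_, fun _ => rfl⟩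
  obtain ⟨ψ, hψ⟩ : ∃ ψ : (Fin 3 → ℝ) → ℝ, ∀ v, ψ v = (v 0 - v 2) / 2 - k * Real.pi := ⟨_, fun _ => rfl⟩
  have hexp0 : ∀ v, Circle.exp (v 0) = Circle.exp (φ v) * Circle.exp (ψ v) := fun v => by
    rw [← Circle.exp_add]
    exact Circle.exp_eq_exp.2 ⟨k, by rw [hφ, hψ]; ring⟩
  have hexp2 : ∀ v, Circle.exp (v 2) = Circle.exp (φ v) * Circle.exp (-ψ v) := fun v => by
    rw [← Circle.exp_add]
    congr 1
    rw [hφ, hψ]; ring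
  have hφ₀ : φ v₀ = v₀ 2 := by rw [hφ, hk]; ring
  have hψ₀ : ψ v₀ = 0 := by rw [hψ, hk]; ring
  have hφc : Continuous φ := by
    have : φ = fun v => (v 0 + v 2) / 2 - k * Real.pi := funext hφ
    rw [this]
    exact (((continuous_apply 0).add (continuous_apply 2)).div_const _).sub continuous_const
  have hψc : Continuous ψ := by
    have : ψ = fun v => (v 0 - v 2) / 2 - k * Real.pi := funext hψ
    rw [this]
    exact (((continuous_apply 0).sub (continuous_apply 2)).div_const _).sub continuous_const
  -- §3: the odd-ised order-0 value vanishes at every centre `δ`-near `e^{iθ₀}`; the value function `z ↦ C · f₀(z·1)` is continuous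
  have hzero : ∀ᶠ z : Circle in 𝓝 (Circle.exp (v₀ 2)), Tendsto (fun ψ : ℝ => (2 * Real.sin ψ) •
        (∫ h : ↥(archLocal L 2 (Matrix.of fun i j : Fin 2 => if i.val + j.val + 1 = 2 then (1 : L) else 0) w),
          f₀ (((h * ⟨Matrix.GeneralLinearGroup.mkOfDetNeZero !![(1 : ℂ), 1; 1, -1] det_cayleyTwo_ne_zero *
                circleDiagonal 2 ![z * Circle.exp ψ, z * Circle.exp (-ψ)] *
                (Matrix.GeneralLinearGroup.mkOfDetNeZero !![(1 : ℂ), 1; 1, -1] det_cayleyTwo_ne_zero)⁻¹,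
              cayley_conj_circleDiagonal_mem_archLocal L w _⟩ * h⁻¹ :
            ↥(archLocal L 2 (Matrix.of fun i j : Fin 2 => if i.val + j.val + 1 = 2 then (1 : L) else 0) w)) : GL (Fin 2) ℂ) : Matrix (Fin 2) (Fin 2) ℂ) ∂νw) -
      (2 * Real.sin (-ψ)) •
        (∫ h : ↥(archLocal L 2 (Matrix.of fun i j : Fin 2 => if i.val + j.val + 1 = 2 then (1 : L) else 0) w),
          f₀ (((h * ⟨Matrix.GeneralLinearGroup.mkOfDetNeZero !![(1 : ℂ), 1; 1, -1] det_cayleyTwo_ne_zero *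
                circleDiagonal 2 ![z * Circle.exp (-ψ), z * Circle.exp (-(-ψ))] *
                (Matrix.GeneralLinearGroup.mkOfDetNeZero !![(1 : ℂ), 1; 1, -1] det_cayleyTwo_ne_zero)⁻¹,
              cayley_conj_circleDiagonal_mem_archLocal L w _⟩ * h⁻¹ :
            ↥(archLocal L 2 (Matrix.of fun i j : Fin 2 => if i.val + j.val + 1 = 2 then (1 : L) else 0) w)) : GL (Fin 2) ℂ) : Matrix (Fin 2) (Fin 2) ℂ) ∂νw))
      (𝓝[>] 0) (𝓝 0) := by
    have hball : ∀ᶠ z : Circle in 𝓝 (Circle.exp (v₀ 2)), dist z (Circle.exp θ₀) < δ := by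
      rw [hv2]
      exact Metric.ball_mem_nhds _ hδ
    filter_upwards [hball] with z hz
    exact tendsto_sub_nhdsGT_zero_of_splitReadings_eq_zero L w νw hf₀s.continuous hf₀c hG1 hz
  have hA : ContinuousAt (fun z : Circle => ((C : ℝ) : ℂ) * f₀ ((z : ℂ) • (1 : Matrix (Fin 2) (Fin 2) ℂ))) (Circle.exp (v₀ 2)) :=
    (continuous_const.mul (hf₀s.continuous.comp (continuous_subtype_val.smul continuous_const))).continuousAt
  -- ★ part 3a: the abstract two-sided quotient lemma
  have hmain := tendsto_sub_apply_neg_div_two_mul_sin (z₀ := Circle.exp (v₀ 2)) hdiff hunif hzero hA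
  rw [hv2, hf₀1, mul_one] at hmain
  -- the coordinate map `v ↦ (e^{iφ(v)}, ψ(v))` tends to `(e^{iθ₀}, 0)` within the regular set, landing in `ψ ≠ 0`
  have hΘ : Tendsto (fun v : Fin 3 → ℝ => (Circle.exp (φ v), ψ v)) (𝓝[{v : Fin 3 → ℝ | Circle.exp (v 0) ≠ Circle.exp (v 2)}] v₀)
      (𝓝 (Circle.exp θ₀) ×ˢ 𝓝[≠] (0 : ℝ)) := by
    refine Tendsto.prodMk ?_ ?_
    · rw [← hv2, ← hφ₀]
      exact ((Circle.exp.continuous.comp hφc).tendsto v₀).mono_left nhdsWithin_le_nhds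
    · refine tendsto_nhdsWithin_iff.2 ⟨?_, eventually_nhdsWithin_of_forall fun v hv => ?_⟩
      · rw [← hψ₀]
        exact (hψc.tendsto v₀).mono_left nhdsWithin_le_nhds
      · intro hψv
        apply hv
        show Circle.exp (v 0) = Circle.exp (v 2)
        rw [hexp0 v, hexp2 v, show ψ v = 0 from hψv, neg_zero]
  refine ((hmain.comp hΘ).congr' (eventually_nhdsWithin_of_forall fun v hv => ?_))
  -- on the regular set `sin ψ(v) ≠ 0`, and the quotient IS the two-sided chart reading (§1)
  have hsin : Real.sin (ψ v) ≠ 0 := by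
    intro hs
    obtain ⟨n, hn⟩ := Real.sin_eq_zero_iff.1 hs
    apply hv
    show Circle.exp (v 0) = Circle.exp (v 2)
    rw [hexp0 v, hexp2 v]
    congr 1
    exact Circle.exp_eq_exp.2 ⟨n, by rw [← hn]; ring⟩
  have hsinC : (2 * (Real.sin (ψ v) : ℂ)) ≠ 0 := mul_ne_zero two_ne_zero (Complex.ofReal_ne_zero.2 hsin)
  dsimp only [Function.comp_apply]
  rw [chartOrbHLoc_eq_integral_cayley_of_not_mem L S w νw hwS f₀ hf₀s.continuous (hexp0 v) (hexp2 v),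
    chartOrbHLoc_eq_integral_cayley_of_not_mem L S w νw hwS f₀ hf₀s.continuous (cw := ![v 2, v 1, v 0]) (z := Circle.exp (φ v)) (ψ := -ψ v)
      (by simpa using hexp2 v) (by simpa using hexp0 v)]
  simp only [neg_neg, Real.sin_neg, Complex.real_smul]
  rw [div_eq_iff hsinC]
  push_cast
  ring

end Head

end Literature.NumberTheory.Rogawski1990

end
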